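import Mathlib
import Literature.MathematicalPhysics.StatisticalMechanics.BarlowStacking
import Literature.MathematicalPhysics.StatisticalMechanics.BarlowCoordination
import Summits.Ventures.Crystal3D.Theorems.StickyWulffConstantLayerChainDefs
import Summits.Ventures.Crystal3D.Theorems.StickyWulffConstantStackingLiminfLayerChainV4Defs
import Summits.Ventures.Crystal3D.Theorems.StickyWulffConstantStackingLiminfTwelveVectors
import Summits.Ventures.Crystal3D.Theorems.StickyWulffConstantStackingLiminfTwelveSlots
import Summits.Ventures.Crystal3D.Theorems.StickyWulffConstantStackingLiminfGridPairCount
import Summits.Ventures.Crystal3D.Theorems.StickyWulffConstantStackingLiminfIndexBox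
import HarnessLib

/-!
# S4(iii) of stub (B) `MollifiedUpper` (line LayerChain v4, crux `StackingLiminf`, stmt-Ventures-19145):
# the OCCUPIED–VACANT PAIR COUNT in a Barlow stacking (transfer of `card_pairs_le` from `ℤ³`)

Cell `crystal3d-full`, venture `Summits/Ventures/Crystal3D`.  BLUEPRINT-v4B S4(iii) / rung R8: for an injective
configuration `x` in the Barlow stacking of a Hägg word `σ`, with index map `a : Fin N → ℤ³`
(`x i = barlowPos (a i)`), every `K ≥ 1` and every finite set `F` of VACANT lattice indices,

`#{(i, t) ∈ univ × F : ‖x_i − barlowPos t‖_∞ < 2K} ≤ (2R+1)³ · 3R · (12N − 2·numContacts x)`, `R = 11⌈K⌉`,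

i.e. `≤ C K⁴ · D`.  Ingredients: the index grid `ℤ³ ∋ (k,i,j) ↦ barlowPos k i j` turns the six unit grid
moves into six of the twelve bond vectors FOR EVERY HÄGG WORD (`offsetPos_up/_down/_layer_eq_sub`), so the
directed grid boundary of the occupied index set is at most the number of vacant slots
`12N − 2·numContacts` (`sum_vacant_add_two_mul_numContacts`, p510328); Hägg labels are 1-Lipschitz in the
layer index (eng's `PlateauHeight.abs_haggLabel_sub_le`, …IndexBox), so a sup-norm displacement `< 2K` forces an
index displacement of `ℓ¹`-size `≤ 11K` (`index_l1_le`); and eng's grid lemma `PlateauHeight.card_pairs_le` (p-landed, …GridPairCount) does the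
counting by subadditivity.  This is the combinatorial input of the skew bound `∫ v·u ≤ C K D`.
WHAT THIS IS NOT: the skew bound S4 (needs also the lateral quadrature); rung F-C1 not moved.
-/

noncomputable section

namespace Summit.Ventures.Crystal3D.Theorems

open Set Function Metric
open Literature.MathematicalPhysics.StatisticalMechanics
open Summit.Ventures.Crystal3D.LayerChain (aVec bPlus bMinus)

variable {N : ℕ}

/-- `√(2/3) ≥ 4/5` and `√3/2 ≥ 4/5`. -/
theorem four_fifths_le_sqrt : (4 : ℝ) / 5 ≤ Real.sqrt (2 / 3) ∧ (4 : ℝ) / 5 ≤ Real.sqrt 3 / 2 := by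
  constructor
  · rw [show (4 : ℝ) / 5 = Real.sqrt ((4 / 5) ^ 2) by rw [Real.sqrt_sq (by norm_num)]]
    exact Real.sqrt_le_sqrt (by norm_num)
  · have : (8 : ℝ) / 5 ≤ Real.sqrt 3 := by
      rw [show (8 : ℝ) / 5 = Real.sqrt ((8 / 5) ^ 2) by rw [Real.sqrt_sq (by norm_num)]]
      exact Real.sqrt_le_sqrt (by norm_num)
    linarith

/-- **Index displacement from position displacement.**  If two lattice points of a Barlow stacking (bond
length `1`) are at sup-norm distance `< 2K`, their indices differ by at most `11K` in `ℓ¹`. -/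
theorem index_l1_le {σ : ℤ → ℤ} (hσ : IsHaggSeq σ) {K : ℝ} {k i j k' i' j' : ℤ}
    (h : ‖WithLp.ofLp (barlowPos 1 (Real.sqrt (2 / 3)) σ k i j) -
      WithLp.ofLp (barlowPos 1 (Real.sqrt (2 / 3)) σ k' i' j')‖ < 2 * K) :
    ((|k - k'| + |i - i'| + |j - j'| : ℤ) : ℝ) ≤ 11 * K := by
  obtain ⟨h23, h32⟩ := four_fifths_le_sqrt
  have hKpos : 0 < K := by
    have := norm_nonneg (WithLp.ofLp (barlowPos 1 (Real.sqrt (2 / 3)) σ k i j) -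
      WithLp.ofLp (barlowPos 1 (Real.sqrt (2 / 3)) σ k' i' j'))
    linarith
  have hc : ∀ l : Fin 3, |(barlowPos 1 (Real.sqrt (2 / 3)) σ k i j) l -
      (barlowPos 1 (Real.sqrt (2 / 3)) σ k' i' j') l| < 2 * K := by
    intro l
    have := norm_le_pi_norm (WithLp.ofLp (barlowPos 1 (Real.sqrt (2 / 3)) σ k i j) -
      WithLp.ofLp (barlowPos 1 (Real.sqrt (2 / 3)) σ k' i' j')) l
    rw [Real.norm_eq_abs] at this
    exact lt_of_le_of_lt this h
  have h2 := hc 2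
  have h1 := hc 1
  have h0 := hc 0
  simp only [barlowPos_apply_two, barlowPos_apply_one, barlowPos_apply_zero, one_mul] at h0 h1 h2
  -- abbreviations
  set dk : ℝ := (k : ℝ) - k' with hdk_def
  set dL : ℝ := (haggLabel σ k : ℝ) - haggLabel σ k' with hdL_def
  set dj : ℝ := (j : ℝ) - j' with hdj_def
  set di : ℝ := (i : ℝ) - i' with hdi_def
  -- the layer difference
  have e2 : (k : ℝ) * Real.sqrt (2 / 3) - k' * Real.sqrt (2 / 3) = dk * Real.sqrt (2 / 3) := by
    rw [hdk_def]; ring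
  rw [e2, abs_mul, abs_of_nonneg (Real.sqrt_nonneg _)] at h2
  have hdk : |dk| ≤ 5 / 2 * K := by
    have : |dk| * (4 / 5) ≤ |dk| * Real.sqrt (2 / 3) := mul_le_mul_of_nonneg_left h23 (abs_nonneg _)
    linarith
  -- the Hägg labels
  have hdL : |dL| ≤ 5 / 2 * K := by
    have hL := PlateauHeight.abs_haggLabel_sub_le hσ k k'
    have hL' : ((|haggLabel σ k - haggLabel σ k'| : ℤ) : ℝ) ≤ ((|k - k'| : ℤ) : ℝ) := by exact_mod_cast hL
    push_cast at hL'
    exact le_trans hL' hdk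
  obtain ⟨hL1, hL2⟩ := abs_le.1 hdL
  -- the second coordinate
  have e1 : Real.sqrt 3 / 2 * ((j : ℝ) + haggLabel σ k / 3) - Real.sqrt 3 / 2 * (j' + haggLabel σ k' / 3) =
      Real.sqrt 3 / 2 * (dj + dL / 3) := by
    rw [hdj_def, hdL_def]; ring
  rw [e1, abs_mul, abs_of_nonneg (by positivity)] at h1
  have h1' : |dj + dL / 3| < 5 / 2 * K := by
    have : 4 / 5 * |dj + dL / 3| ≤ Real.sqrt 3 / 2 * |dj + dL / 3| :=
      mul_le_mul_of_nonneg_right h32 (abs_nonneg _)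
    linarith
  obtain ⟨hj1, hj2⟩ := abs_lt.1 h1'
  have hdj : |dj| ≤ 17 / 5 * K := abs_le.2 ⟨by linarith, by linarith⟩
  obtain ⟨hj3, hj4⟩ := abs_le.1 hdj
  -- the first coordinate
  have e0 : (i : ℝ) + j / 2 + haggLabel σ k / 2 - (i' + j' / 2 + haggLabel σ k' / 2) =
      di + dj / 2 + dL / 2 := by
    rw [hdi_def, hdj_def, hdL_def]; ring
  rw [e0] at h0
  obtain ⟨hi1, hi2⟩ := abs_lt.1 h0
  have hdi : |di| ≤ 5 * K := abs_le.2 ⟨by linarith, by linarith⟩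
  -- conclude
  have e3 : (((|k - k'| + |i - i'| + |j - j'| : ℤ)) : ℝ) = |dk| + |di| + |dj| := by
    rw [hdk_def, hdi_def, hdj_def]; push_cast; ring
  rw [e3]
  linarith

/-- The six unit moves of the index grid. -/
theorem unit_move_cases (u : ℤ × ℤ × ℤ) (hu : |u.1| + |u.2.1| + |u.2.2| = 1) :
    u = (1, 0, 0) ∨ u = (-1, 0, 0) ∨ u = (0, 1, 0) ∨ u = (0, -1, 0) ∨ u = (0, 0, 1) ∨ u = (0, 0, -1) := by
  obtain ⟨a, b, c⟩ := u
  simp only at hu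
  simp only [Prod.mk.injEq]
  rcases abs_cases a with ⟨ha, _⟩ | ⟨ha, _⟩ <;> rcases abs_cases b with ⟨hb, _⟩ | ⟨hb, _⟩ <;>
    rcases abs_cases c with ⟨hc, _⟩ | ⟨hc, _⟩ <;> omega

/-- Distinct indices give distinct lattice points (bond length `1`, layer spacing `√(2/3)`). -/
theorem barlowPos_ne_of_ne (σ : ℤ → ℤ) {t t' : ℤ × ℤ × ℤ} (h : t ≠ t') :
    barlowPos 1 (Real.sqrt (2 / 3)) σ t.1 t.2.1 t.2.2 ≠ barlowPos 1 (Real.sqrt (2 / 3)) σ t'.1 t'.2.1 t'.2.2 := by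
  intro heq
  have hne : (t.1, t.2.1, t.2.2) ≠ (t'.1, t'.2.1, t'.2.2) := by simpa using h
  have hd := le_dist_barlowPos 1 (Real.sqrt (2 / 3)) σ zero_le_one (Real.sqrt_nonneg _) hne
  rw [heq, dist_self] at hd
  have : (0 : ℝ) < min 1 (Real.sqrt (2 / 3)) := lt_min one_pos (Real.sqrt_pos.2 (by norm_num))
  linarith

/-- **A unit grid move from an occupied index lands in one of the twelve neighbour slots.** -/
theorem barlowPos_add_unit_mem_slots {σ : ℤ → ℤ} (hσ : IsHaggSeq σ) (t u : ℤ × ℤ × ℤ)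
    (hu : |u.1| + |u.2.1| + |u.2.2| = 1) :
    barlowPos 1 (Real.sqrt (2 / 3)) σ (t + u).1 (t + u).2.1 (t + u).2.2 ∈
      ((Finset.univ.image fun m : Fin 3 =>
          barlowPos 1 (Real.sqrt (2 / 3)) σ t.1 t.2.1 t.2.2 + WithLp.toLp 2 (aVec m)) ∪
        (Finset.univ.image fun m : Fin 3 =>
          barlowPos 1 (Real.sqrt (2 / 3)) σ t.1 t.2.1 t.2.2 - WithLp.toLp 2 (aVec m)) ∪
        (Finset.univ.image fun m : Fin 3 =>
          barlowPos 1 (Real.sqrt (2 / 3)) σ t.1 t.2.1 t.2.2 +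
            WithLp.toLp 2 (if σ t.1 = 1 then bPlus m else bMinus m)) ∪
        (Finset.univ.image fun m : Fin 3 =>
          barlowPos 1 (Real.sqrt (2 / 3)) σ t.1 t.2.1 t.2.2 -
            WithLp.toLp 2 (if σ (t.1 - 1) = 1 then bPlus m else bMinus m))) := by
  obtain ⟨k, i, j⟩ := t
  have h00 : ∀ τ : ℤ, ((0 : ℤ), (0 : ℤ)) ∈ threeOffsets τ := by
    intro τ; unfold threeOffsets; split_ifs <;> simp
  simp only [Finset.mem_union, Finset.mem_image, Finset.mem_univ, true_and]
  rcases unit_move_cases u hu with rfl | rfl | rfl | rfl | rfl | rfl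
  · -- up: (k+1, i, j)
    obtain ⟨m, hm⟩ := offsetPos_up hσ i j k (0, 0) (h00 _)
    refine Or.inl (Or.inr ⟨m, ?_⟩)
    rw [← hm]
    simp [offsetPos]
  · -- down: (k-1, i, j)
    obtain ⟨m, hm⟩ := offsetPos_down hσ i j k (0, 0) (h00 _)
    refine Or.inr ⟨m, ?_⟩
    rw [← hm]
    simp [offsetPos, sub_eq_add_neg]
  · -- (k, i+1, j) = x + a₀
    refine Or.inl (Or.inl (Or.inl ⟨0, ?_⟩))
    have h := offsetPos_layer_eq_sub σ i j k (-1) 0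
    simp only [offsetPos, sub_neg_eq_add, sub_zero, Int.cast_neg, Int.cast_one, neg_smul, one_smul,
      sub_neg_eq_add, Int.cast_zero, zero_smul] at h
    simpa using h.symm
  · -- (k, i-1, j) = x - a₀
    refine Or.inl (Or.inl (Or.inr ⟨0, ?_⟩))
    have h := offsetPos_layer_eq_sub σ i j k 1 0
    simp only [offsetPos, sub_zero, Int.cast_one, one_smul, Int.cast_zero, zero_smul] at h
    simpa [sub_eq_add_neg] using h.symm
  · -- (k, i, j+1) = x + a₁
    refine Or.inl (Or.inl (Or.inl ⟨1, ?_⟩))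
    have h := offsetPos_layer_eq_sub σ i j k 0 (-1)
    simp only [offsetPos, sub_neg_eq_add, sub_zero, Int.cast_neg, Int.cast_one, neg_smul, one_smul,
      Int.cast_zero, zero_smul] at h
    simpa using h.symm
  · -- (k, i, j-1) = x - a₁
    refine Or.inl (Or.inl (Or.inr ⟨1, ?_⟩))
    have h := offsetPos_layer_eq_sub σ i j k 0 1
    simp only [offsetPos, sub_zero, Int.cast_one, one_smul, Int.cast_zero, zero_smul] at h
    simpa [sub_eq_add_neg] using h.symm

/-- **The directed grid boundary of the occupied index set is at most the number of vacant slots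
`12N − 2·numContacts`.** -/
theorem card_gridBoundary_le {σ : ℤ → ℤ} (hσ : IsHaggSeq σ) (x : Fin N → EuclideanSpace ℝ (Fin 3))
    (hx : Function.Injective x) (a : Fin N → ℤ × ℤ × ℤ)
    (ha : ∀ i, x i = barlowPos 1 (Real.sqrt (2 / 3)) σ (a i).1 (a i).2.1 (a i).2.2)
    (u : ℤ × ℤ × ℤ) (hu : |u.1| + |u.2.1| + |u.2.2| = 1) :
    ((Finset.univ.image a).filter fun t => t + u ∉ Finset.univ.image a).card ≤
      12 * N - 2 * Summit.Ventures.Crystal3D.numContacts x := by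
  classical
  have hmem : ∀ i, x i ∈ barlowStacking 1 (Real.sqrt (2 / 3)) σ := fun i => by
    rw [ha i]; exact barlowPos_mem _ _ _
  have hkf : ∀ i, x i 2 = ((a i).1 : ℤ) * Real.sqrt (2 / 3) := fun i => by
    rw [ha i, barlowPos_apply_two]
  have hslots := sum_vacant_add_two_mul_numContacts hσ x hx hmem (fun i => (a i).1) hkf
  -- filter through the index map
  rw [Finset.filter_image]
  refine le_trans Finset.card_image_le ?_
  rw [Finset.card_filter]
  have hpt : ∀ i : Fin N, (if a i + u ∉ Finset.univ.image a then 1 else 0) ≤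
      ((((Finset.univ.image fun m : Fin 3 => x i + WithLp.toLp 2 (aVec m)) ∪
          (Finset.univ.image fun m : Fin 3 => x i - WithLp.toLp 2 (aVec m)) ∪
          (Finset.univ.image fun m : Fin 3 =>
            x i + WithLp.toLp 2 (if σ (a i).1 = 1 then bPlus m else bMinus m)) ∪
          (Finset.univ.image fun m : Fin 3 =>
            x i - WithLp.toLp 2 (if σ ((a i).1 - 1) = 1 then bPlus m else bMinus m)))).filter
        fun w => w ∉ Set.range x).card := by
    intro i
    by_cases hvac : a i + u ∉ Finset.univ.image a
    · rw [if_pos hvac]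
      refine Finset.one_le_card.2 ⟨barlowPos 1 (Real.sqrt (2 / 3)) σ (a i + u).1 (a i + u).2.1 (a i + u).2.2, ?_⟩
      rw [Finset.mem_filter]
      refine ⟨?_, ?_⟩
      · have h := barlowPos_add_unit_mem_slots hσ (a i) u hu
        rw [ha i]
        exact h
      · rintro ⟨j, hj⟩
        apply hvac
        rw [ha j] at hj
        have : a j = a i + u := by
          by_contra hne
          exact barlowPos_ne_of_ne σ hne hj
        exact Finset.mem_image.2 ⟨j, Finset.mem_univ _, this⟩
    · rw [if_neg hvac]
      exact Nat.zero_le _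
  have hsum : (∑ i, (if a i + u ∉ Finset.univ.image a then 1 else 0)) ≤
      ∑ i, ((((Finset.univ.image fun m : Fin 3 => x i + WithLp.toLp 2 (aVec m)) ∪
          (Finset.univ.image fun m : Fin 3 => x i - WithLp.toLp 2 (aVec m)) ∪
          (Finset.univ.image fun m : Fin 3 =>
            x i + WithLp.toLp 2 (if σ (a i).1 = 1 then bPlus m else bMinus m)) ∪
          (Finset.univ.image fun m : Fin 3 =>
            x i - WithLp.toLp 2 (if σ ((a i).1 - 1) = 1 then bPlus m else bMinus m)))).filter
        fun w => w ∉ Set.range x).card :=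
    Finset.sum_le_sum fun i _ => hpt i
  omega

/-- **The occupied–vacant pair count (BLUEPRINT S4(iii) / rung R8).**  Pairs (occupied ball, vacant
lattice index in `F`) at sup-norm distance `< 2K` number at most `(2R+1)³ · 3R · (12N − 2·numContacts)`,
`R = 11⌈K⌉`. -/
theorem card_nearVacantPairs_le {σ : ℤ → ℤ} (hσ : IsHaggSeq σ) (x : Fin N → EuclideanSpace ℝ (Fin 3))
    (hx : Function.Injective x) (a : Fin N → ℤ × ℤ × ℤ)
    (ha : ∀ i, x i = barlowPos 1 (Real.sqrt (2 / 3)) σ (a i).1 (a i).2.1 (a i).2.2) (K : ℝ)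
    (F : Finset (ℤ × ℤ × ℤ))
    (hF : ∀ t ∈ F, barlowPos 1 (Real.sqrt (2 / 3)) σ t.1 t.2.1 t.2.2 ∉ Set.range x) :
    ((Finset.univ ×ˢ F).filter fun q : Fin N × (ℤ × ℤ × ℤ) =>
        ‖WithLp.ofLp (x q.1) - WithLp.ofLp (barlowPos 1 (Real.sqrt (2 / 3)) σ q.2.1 q.2.2.1 q.2.2.2)‖ <
          2 * K).card ≤
      (2 * (11 * ⌈K⌉₊) + 1) ^ 3 * (3 * (11 * ⌈K⌉₊)) * (12 * N - 2 * Summit.Ventures.Crystal3D.numContacts x) := by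
  classical
  set R : ℕ := 11 * ⌈K⌉₊ with hR
  set X : Finset (ℤ × ℤ × ℤ) := Finset.univ.image a with hX
  set B : Finset (ℤ × ℤ × ℤ) :=
    (Finset.Icc (-(R : ℤ)) R) ×ˢ ((Finset.Icc (-(R : ℤ)) R) ×ˢ (Finset.Icc (-(R : ℤ)) R)) with hB
  have hainj : Function.Injective a := fun i j h => hx (by rw [ha i, ha j, h])
  have hBcard : B.card = (2 * R + 1) ^ 3 := by
    rw [hB, Finset.card_product, Finset.card_product, Int.card_Icc]
    have : ((R : ℤ) + 1 - -(R : ℤ)).toNat = 2 * R + 1 := by omega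
    rw [this]; ring
  have hBl1 : ∀ Δ ∈ B, (|Δ.1| + |Δ.2.1| + |Δ.2.2|).toNat ≤ 3 * R := by
    intro Δ hΔ
    simp only [hB, Finset.mem_product, Finset.mem_Icc] at hΔ
    obtain ⟨⟨h1, h2⟩, ⟨h3, h4⟩, ⟨h5, h6⟩⟩ := hΔ
    have e1 := abs_le.2 ⟨h1, h2⟩
    have e2 := abs_le.2 ⟨h3, h4⟩
    have e3 := abs_le.2 ⟨h5, h6⟩
    omega
  have hM : ∀ u : ℤ × ℤ × ℤ, |u.1| + |u.2.1| + |u.2.2| = 1 →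
      (X.filter fun t => t + u ∉ X).card ≤ 12 * N - 2 * Summit.Ventures.Crystal3D.numContacts x :=
    fun u hu => card_gridBoundary_le hσ x hx a ha u hu
  have hgrid := PlateauHeight.card_pairs_le X B (3 * R) (12 * N - 2 * Summit.Ventures.Crystal3D.numContacts x)
    hBl1 hM
  rw [hBcard] at hgrid
  refine le_trans ?_ hgrid
  refine Finset.card_le_card_of_injOn (fun q => (a q.1, q.2 - a q.1)) ?_ ?_
  · intro q hq
    rw [Finset.mem_coe, Finset.mem_filter, Finset.mem_product] at hq
    obtain ⟨⟨-, htF⟩, hdist⟩ := hq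
    rw [Finset.mem_coe, Finset.mem_filter, Finset.mem_product]
    refine ⟨⟨Finset.mem_image_of_mem a (Finset.mem_univ _), ?_⟩, ?_⟩
    · -- the displacement lies in the box
      rw [ha q.1] at hdist
      have hl1 := index_l1_le hσ hdist
      have hKR : 11 * K ≤ (R : ℝ) := by
        rw [hR]; push_cast
        have := Nat.le_ceil K
        linarith
      have hl1' : ((|(a q.1).1 - q.2.1| + |(a q.1).2.1 - q.2.2.1| + |(a q.1).2.2 - q.2.2.2| : ℤ) : ℝ) ≤
          ((R : ℤ) : ℝ) := by
        exact_mod_cast (le_trans hl1 hKR)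
      have hl1'' : |(a q.1).1 - q.2.1| + |(a q.1).2.1 - q.2.2.1| + |(a q.1).2.2 - q.2.2.2| ≤ (R : ℤ) := by
        exact_mod_cast hl1'
      simp only [hB, Finset.mem_product, Finset.mem_Icc, Prod.fst_sub, Prod.snd_sub]
      have g1 := abs_nonneg ((a q.1).1 - q.2.1)
      have g2 := abs_nonneg ((a q.1).2.1 - q.2.2.1)
      have g3 := abs_nonneg ((a q.1).2.2 - q.2.2.2)
      have f1 := abs_le.1 (show |(a q.1).1 - q.2.1| ≤ (R : ℤ) by linarith)
      have f2 := abs_le.1 (show |(a q.1).2.1 - q.2.2.1| ≤ (R : ℤ) by linarith)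
      have f3 := abs_le.1 (show |(a q.1).2.2 - q.2.2.2| ≤ (R : ℤ) by linarith)
      refine ⟨⟨?_, ?_⟩, ⟨?_, ?_⟩, ⟨?_, ?_⟩⟩ <;> linarith [f1.1, f1.2, f2.1, f2.2, f3.1, f3.2]
    · -- the target index is vacant
      intro hmemX
      rw [add_sub_cancel] at hmemX
      obtain ⟨j, -, hj⟩ := Finset.mem_image.1 hmemX
      apply hF q.2 htF
      refine ⟨j, ?_⟩
      rw [ha j, hj]
  · intro q hq q' hq' heq
    simp only [Prod.mk.injEq] at heq
    obtain ⟨h1, h2⟩ := heq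
    have hq1 : q.1 = q'.1 := hainj h1
    rw [h1] at h2
    exact Prod.ext hq1 (sub_left_injective h2)

end Summit.Ventures.Crystal3D.Theorems

end
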